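import Summits.KontsevichZagierPeriods.KontsevichZagierPeriods.Theorems.SoloBlindLandenTower
import HarnessLib

/-!
# Landen's transformation inside the rules, IV: the lemniscatic orbit in the sector

`K_½, E_½, K_{λ₁}, E_{λ₁}` (`λ₁ = 12√2 - 16`) lie in the lemniscate sector `M(A₂,B₂)` of
`SoloBlindLemniscateSector`, with `[E_{λ₁}] = (√2-1)·[A₂] + (2√2-2)·[B₂]` (`mkQ_ellE_landenOne`);
one step DOWN, `k₋ = 3 - 2√2` has `λ(k₋) = ½` (`landenMod_kD`, and `k₋² + λ₁ = 1`), so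
`K_{k₋²}, E_{k₋²} ∈ M(A₂,B₂)`, explicitly `[K_{k₋²}] = ((1+√2)/2)·[A₂]`,
`[E_{k₋²}] = [A₂] + (√2-1)·[B₂]` (`mkQ_ellK_kD`, `mkQ_ellE_kD`: `K(3-2√2) = ((1+√2)/2)·a`,
`E(3-2√2) = a + (√2-1)·b`); and for EVERY `n` the tower moduli `k_n = landenSeq k₋ n`
(`k₁² = ½`, `k₂² = λ₁`, …) give `K_{k_n²}, E_{k_n²} ∈ M(A₂,B₂)`
(`of_landenSeq_kD_mem_lemniscateSector`).
On that sector the Kontsevich–Zagier conjecture is an unconditional theorem, so it holds for all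
these complete elliptic integrals against every representation of the sector
(`kz_ellK_landenSeq`, `kz_ellE_landenSeq`, `kz_ellK_landenDesc`, `kz_ellK_landenOne`, …);
the second-kind values `E(k₁)`, `E(k₋)` are transcendental (`transcendental_lemn_comb`).
-/

noncomputable section

namespace Summit.KontsevichZagierPeriods.KontsevichZagierPeriods.Theorems

open Set MeasureTheory
open Literature.ModelTheory.ExponentialFields (IsSemialgebraic)
open Literature.NumberTheory.Transcendental
open Literature.NumberTheory.Transcendental.KZ

namespace SoloBlind

section LemniscaticOrbit

/-! ## Membership in the lemniscate sector and the conjecture -/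

/-- `K_½ ∈ M(A₂,B₂)`. -/
theorem of_ellK_half_mem_lemniscateSector :
    of (ellK (kL ^ 2) (isAlgebraic_kL.pow 2) (sq_mem_Ioo kL kL_mem)) ∈ lemniscateSector := by
  rw [mem_lemniscateSector, mkQ_ellK_half]
  exact Subalgebra.smul_mem _ (mem_lemniscateSector.mp of_lemnA2_mem_lemniscateSector) _

/-- `E_½ ∈ M(A₂,B₂)`. -/
theorem of_ellE_half_mem_lemniscateSector :
    of (ellE (kL ^ 2) (isAlgebraic_kL.pow 2) (sq_mem_Ioo kL kL_mem)) ∈ lemniscateSector := by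
  rw [mem_lemniscateSector, mkQ_ellE_half]
  exact Subalgebra.smul_mem _ (add_mem (mem_lemniscateSector.mp of_lemnA2_mem_lemniscateSector)
    (mem_lemniscateSector.mp of_lemnB2_mem_lemniscateSector)) _

/-- **`K_{λ₁} ∈ M(A₂,B₂)`.** -/
theorem of_ellK_landenOne_mem_lemniscateSector :
    of (ellK (landenMod kL) (isAlgebraic_landenMod isAlgebraic_kL) (landenMod_mem kL_mem)) ∈
      lemniscateSector := by
  rw [mem_lemniscateSector, mkQ_ellK_landenOne]
  exact Subalgebra.smul_mem _ (mem_lemniscateSector.mp of_lemnA2_mem_lemniscateSector) _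

/-- **`E_{λ₁} ∈ M(A₂,B₂)`** (by Landen II: `(1+k)[E_λ] = 2[E_{k²}] - (1-k²)[K_{k²}]`). -/
theorem of_ellE_landenOne_mem_lemniscateSector :
    of (ellE (landenMod kL) (isAlgebraic_landenMod isAlgebraic_kL) (landenMod_mem kL_mem)) ∈
      lemniscateSector :=
  mem_lemniscateSector.mpr (landen_ascend_mem kL isAlgebraic_kL kL_mem _
    (mem_lemniscateSector.mp of_ellK_half_mem_lemniscateSector)
    (mem_lemniscateSector.mp of_ellE_half_mem_lemniscateSector)).2

/-- **`[E_{λ₁}] = (√2 - 1)·[A₂] + (2√2 - 2)·[B₂]`** in `Q`, i.e.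
`E(k₁) = (√2-1)·a + (2√2-2)·b` with Euler's `a = ∫₀¹dx/√(1-x⁴)`, `b = ∫₀¹x²dx/√(1-x⁴)`. -/
theorem mkQ_ellE_landenOne :
    mkQ (of (ellE (landenMod kL) (isAlgebraic_landenMod isAlgebraic_kL) (landenMod_mem kL_mem))) =
      (sqrtTwo - 1) • mkQ (of lemnA2) + (2 * sqrtTwo - 2) • mkQ (of lemnB2) := by
  set c : K₀ := ⟨1 + kL, mem_K₀_iff.mpr (isAlgebraic_one.add isAlgebraic_kL)⟩ with hc
  set p : K₀ := sqrtTwo - 1 with hp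
  set q : K₀ := 2 * sqrtTwo - 2 with hq
  set d : K₀ := ⟨1 - kL ^ 2, mem_K₀_iff.mpr (isAlgebraic_one.sub (isAlgebraic_kL.pow 2))⟩ with hd
  set e : K₀ := ⟨2, mem_K₀_iff.mpr (isAlgebraic_nat 2)⟩ with he
  set l : K₀ := ⟨kL, mem_K₀_iff.mpr isAlgebraic_kL⟩ with hl
  have hc0 : c ≠ 0 := by
    intro h0
    have h1 : (c : ℝ) = 0 := by rw [h0]; rfl
    have h2 := kL_mem.1
    rw [hc] at h1
    change 1 + kL = 0 at h1
    linarith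
  have h := mkQ_landen_second kL isAlgebraic_kL kL_mem
  rw [mkQ_ellK_half, mkQ_ellE_half, ← hc, ← hd, ← he, ← hl] at h
  have h22 : Real.sqrt 2 * Real.sqrt 2 = 2 := Real.mul_self_sqrt zero_le_two
  have hkL : kL = Real.sqrt 2 / 2 := rfl
  have hp' : c * p = e * l - d * sqrtTwo := by
    apply Subtype.ext
    show (1 + kL) * (Real.sqrt 2 - 1) = 2 * kL - (1 - kL ^ 2) * Real.sqrt 2
    rw [hkL]; linear_combination (1 / 2 - Real.sqrt 2 / 4) * h22
  have hq' : c * q = e * l := by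
    apply Subtype.ext
    show (1 + kL) * (2 * Real.sqrt 2 - 2) = 2 * kL
    rw [hkL]; linear_combination h22
  refine smul_right_injective Q hc0 ?_
  show c • _ = c • (p • mkQ (of lemnA2) + q • mkQ (of lemnB2))
  calc c • mkQ (of (ellE (landenMod kL) (isAlgebraic_landenMod isAlgebraic_kL)
        (landenMod_mem kL_mem)))
      = e • l • (mkQ (of lemnA2) + mkQ (of lemnB2)) - d • sqrtTwo • mkQ (of lemnA2) :=
        eq_sub_of_add_eq h
    _ = (e * l - d * sqrtTwo) • mkQ (of lemnA2) + (e * l) • mkQ (of lemnB2) := by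
        simp only [sub_smul, mul_smul, smul_add]; abel
    _ = c • (p • mkQ (of lemnA2) + q • mkQ (of lemnB2)) := by
        rw [← hp', ← hq', smul_add, mul_smul, mul_smul]

/-- **`E(k₁) = (√2-1)·a + (2√2-2)·b`**, `k₁² = 12√2 - 16`. -/
theorem ellE_landenOne_value :
    (ellE (landenMod kL) (isAlgebraic_landenMod isAlgebraic_kL) (landenMod_mem kL_mem)).value =
      (Real.sqrt 2 - 1) * lemnA2.value + (2 * Real.sqrt 2 - 2) * lemnB2.value := by
  have h := congrArg evalQ mkQ_ellE_landenOne
  rw [evalQ_mkQ, eval_of, map_add, evalQ_smul, evalQ_smul, evalQ_mkQ, evalQ_mkQ, eval_of,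
    eval_of] at h
  have h2 : ((2 : K₀) : ℝ) = 2 := rfl
  rw [h]; push_cast [coe_sqrtTwo, h2]; ring

/-! ## One Landen step DOWN from the lemniscatic modulus: `k₋ = 3 - 2√2`, `λ(k₋) = ½` -/

/-- `k₋ = 3 - 2√2 = (√2 - 1)²`, the modulus one Landen step below `k² = ½`. -/
def kD : ℝ := 3 - 2 * Real.sqrt 2

/-- `k₋ ∈ (0,1)`. -/
theorem kD_mem : kD ∈ Ioo (0:ℝ) 1 := by
  have h22 : Real.sqrt 2 * Real.sqrt 2 = 2 := Real.mul_self_sqrt zero_le_two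
  have hs1 : 1 < Real.sqrt 2 := by
    rw [show (1:ℝ) = Real.sqrt 1 by simp]; exact Real.sqrt_lt_sqrt (by norm_num) (by norm_num)
  have hs2 : Real.sqrt 2 < 3 / 2 := by nlinarith [h22, Real.sqrt_nonneg 2]
  exact ⟨by unfold kD; linarith, by unfold kD; linarith⟩

/-- `k₋` is algebraic. -/
theorem isAlgebraic_kD : IsAlgebraic ℚ kD :=
  (isAlgebraic_nat 3).sub ((isAlgebraic_nat 2).mul isAlgebraic_sqrtTwo)

/-- **`λ(k₋) = ½ = k_L²`**: the Landen step from `k₋` lands on the lemniscatic modulus. -/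
theorem landenMod_kD : landenMod kD = kL ^ 2 := by
  have h22 : Real.sqrt 2 * Real.sqrt 2 = 2 := Real.mul_self_sqrt zero_le_two
  have hD : (0:ℝ) < (1 + kD) ^ 2 := by have := kD_mem.1; positivity
  rw [landenMod, kL_sq, div_eq_iff hD.ne', kD]
  linear_combination (-2) * h22

/-- `k₋² + λ₁ = 1`: the moduli one step below and one step above `½` are complementary
(`17 - 12√2` and `12√2 - 16`), as befits the singular modulus `k² = ½` with `K' = K`. -/
theorem kD_sq_add_landenMod_kL : kD ^ 2 + landenMod kL = 1 := by
  have h22 : Real.sqrt 2 * Real.sqrt 2 = 2 := Real.mul_self_sqrt zero_le_two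
  rw [landenMod_kL, kD]
  linear_combination 4 * h22

/-- **`K_{k₋²}, E_{k₋²} ∈ M(A₂,B₂)`**, `k₋² = 17 - 12√2` (descending step from `K_½, E_½`). -/
theorem of_ellK_ellE_kD_mem_lemniscateSector :
    of (ellK (kD ^ 2) (isAlgebraic_kD.pow 2) (sq_mem_Ioo kD kD_mem)) ∈ lemniscateSector ∧
      of (ellE (kD ^ 2) (isAlgebraic_kD.pow 2) (sq_mem_Ioo kD kD_mem)) ∈ lemniscateSector := by
  have hK := mem_lemniscateSector.mp of_ellK_half_mem_lemniscateSector
  have hE := mem_lemniscateSector.mp of_ellE_half_mem_lemniscateSector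
  rw [← ellK_congr landenMod_kD (ha := isAlgebraic_landenMod isAlgebraic_kD)
    (hμ := landenMod_mem kD_mem)] at hK
  rw [← ellE_congr landenMod_kD (ha := isAlgebraic_landenMod isAlgebraic_kD)
    (hμ := landenMod_mem kD_mem)] at hE
  have h := landen_descend_mem kD isAlgebraic_kD kD_mem _ hK hE
  exact ⟨mem_lemniscateSector.mpr h.1, mem_lemniscateSector.mpr h.2⟩

/-- The coefficient `(1 + √2)/2 ∈ K₀`. -/
def halfOnePlusSqrtTwo : K₀ :=
  ⟨(1 + Real.sqrt 2) / 2, mem_K₀_iff.mpr (by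
    rw [div_eq_mul_inv]
    exact (isAlgebraic_one.add isAlgebraic_sqrtTwo).mul (isAlgebraic_nat 2).inv)⟩

/-- **`[K_{k₋²}] = ((1+√2)/2)·[A₂]`** in `Q`: `K(3 - 2√2) = ((1+√2)/2)·∫₀¹ dx/√(1-x⁴)`. -/
theorem mkQ_ellK_kD : mkQ (of (ellK (kD ^ 2) (isAlgebraic_kD.pow 2) (sq_mem_Ioo kD kD_mem))) =
    halfOnePlusSqrtTwo • mkQ (of lemnA2) := by
  set c : K₀ := ⟨1 + kD, mem_K₀_iff.mpr (isAlgebraic_one.add isAlgebraic_kD)⟩ with hc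
  have hc0 : c ≠ 0 := one_add_ne_zero_K₀ kD isAlgebraic_kD kD_mem
  have h := mkQ_ellK_landen kD isAlgebraic_kD kD_mem
  rw [ellK_congr landenMod_kD (ha' := isAlgebraic_kL.pow 2) (hμ' := sq_mem_Ioo kL kL_mem),
    mkQ_ellK_half, ← hc] at h
  have h22 : Real.sqrt 2 * Real.sqrt 2 = 2 := Real.mul_self_sqrt zero_le_two
  have hcoef : c * halfOnePlusSqrtTwo = sqrtTwo := by
    apply Subtype.ext
    show (1 + kD) * ((1 + Real.sqrt 2) / 2) = Real.sqrt 2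
    rw [kD]; linear_combination (-1) * h22
  refine smul_right_injective Q hc0 ?_
  show c • _ = c • (halfOnePlusSqrtTwo • mkQ (of lemnA2))
  rw [← h, smul_smul, hcoef]

/-- **`[E_{k₋²}] = [A₂] + (√2-1)·[B₂]`** in `Q`:
`E(3 - 2√2) = ∫₀¹ dx/√(1-x⁴) + (√2-1)·∫₀¹ x²dx/√(1-x⁴)`. -/
theorem mkQ_ellE_kD : mkQ (of (ellE (kD ^ 2) (isAlgebraic_kD.pow 2) (sq_mem_Ioo kD kD_mem))) =
    mkQ (of lemnA2) + (sqrtTwo - 1) • mkQ (of lemnB2) := by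
  set c : K₀ := ⟨1 + kD, mem_K₀_iff.mpr (isAlgebraic_one.add isAlgebraic_kD)⟩ with hc
  set d : K₀ := ⟨1 - kD ^ 2, mem_K₀_iff.mpr (isAlgebraic_one.sub (isAlgebraic_kD.pow 2))⟩ with hd
  set e : K₀ := ⟨2, mem_K₀_iff.mpr (isAlgebraic_nat 2)⟩ with he
  set l : K₀ := ⟨kL, mem_K₀_iff.mpr isAlgebraic_kL⟩ with hl
  set q : K₀ := sqrtTwo - 1 with hq
  have he0 : e ≠ 0 := by
    intro h0
    have h1 := congrArg Subtype.val h0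
    change (2:ℝ) = 0 at h1
    norm_num at h1
  have h := mkQ_landen_second kD isAlgebraic_kD kD_mem
  rw [ellE_congr landenMod_kD (ha' := isAlgebraic_kL.pow 2) (hμ' := sq_mem_Ioo kL kL_mem),
    mkQ_ellE_half, mkQ_ellK_kD, ← hc, ← hd, ← he, ← hl] at h
  have h22 : Real.sqrt 2 * Real.sqrt 2 = 2 := Real.mul_self_sqrt zero_le_two
  have hkL : kL = Real.sqrt 2 / 2 := rfl
  have h1 : c * l + d * halfOnePlusSqrtTwo = e := by
    apply Subtype.ext
    show (1 + kD) * kL + (1 - kD ^ 2) * ((1 + Real.sqrt 2) / 2) = 2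
    rw [kD, hkL]; linear_combination (3 - 2 * Real.sqrt 2) * h22
  have h2 : c * l = e * q := by
    apply Subtype.ext
    show (1 + kD) * kL = 2 * (Real.sqrt 2 - 1)
    rw [kD, hkL]; linear_combination (-1) * h22
  refine smul_right_injective Q he0 ?_
  show e • _ = e • (mkQ (of lemnA2) + q • mkQ (of lemnB2))
  rw [← h]
  calc c • l • (mkQ (of lemnA2) + mkQ (of lemnB2)) + d • halfOnePlusSqrtTwo • mkQ (of lemnA2)
      = (c * l + d * halfOnePlusSqrtTwo) • mkQ (of lemnA2) + (c * l) • mkQ (of lemnB2) := by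
        simp only [add_smul, mul_smul, smul_add]; abel
    _ = e • (mkQ (of lemnA2) + q • mkQ (of lemnB2)) := by rw [h1, h2, smul_add, mul_smul]

/-- **`K(k₋) = ((1+√2)/2)·a`**, `k₋² = 17 - 12√2`, `a = ∫₀¹ dx/√(1-x⁴)`. -/
theorem ellK_kD_value :
    (ellK (kD ^ 2) (isAlgebraic_kD.pow 2) (sq_mem_Ioo kD kD_mem)).value =
      (1 + Real.sqrt 2) / 2 * lemnA2.value := by
  have h := congrArg evalQ mkQ_ellK_kD
  rw [evalQ_mkQ, eval_of, evalQ_smul, evalQ_mkQ, eval_of] at h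
  rw [h]; rfl

/-- **`E(k₋) = a + (√2-1)·b`**, `b = ∫₀¹ x²dx/√(1-x⁴)`. -/
theorem ellE_kD_value :
    (ellE (kD ^ 2) (isAlgebraic_kD.pow 2) (sq_mem_Ioo kD kD_mem)).value =
      lemnA2.value + (Real.sqrt 2 - 1) * lemnB2.value := by
  have h := congrArg evalQ mkQ_ellE_kD
  rw [evalQ_mkQ, eval_of, map_add, evalQ_smul, evalQ_mkQ, evalQ_mkQ, eval_of, eval_of] at h
  rw [h]; push_cast [coe_sqrtTwo]; ring

/-! ## Transcendence of the second-kind values -/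

/-- A `K₀`-linear combination `p·a + q·b` of the lemniscatic periods with `q ≠ 0` is transcendental
(from the algebraic independence of `a, b` over `K₀`). -/
theorem transcendental_lemn_comb (p q : K₀) (hq : q ≠ 0) :
    Transcendental ℚ ((p : ℝ) * lemnA2.value + (q : ℝ) * lemnB2.value) := by
  intro halg
  set r : K₀ := ⟨_, mem_K₀_iff.mpr halg⟩ with hr
  have hind := algebraicIndependent_evalQ_lemnGen
  rw [evalQ_lemnGen] at hind
  let P : MvPolynomial (Fin 2) K₀ :=
    MvPolynomial.C p * MvPolynomial.X 0 + MvPolynomial.C q * MvPolynomial.X 1 - MvPolynomial.C r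
  have hP : MvPolynomial.aeval ![lemnA2.value, lemnB2.value] P = 0 := by
    simp only [P, map_sub, map_add, map_mul, MvPolynomial.aeval_C, MvPolynomial.aeval_X,
      Matrix.cons_val_zero, Matrix.cons_val_one]
    change (p : ℝ) * lemnA2.value + (q : ℝ) * lemnB2.value - (r : ℝ) = 0
    rw [hr]; exact sub_self _
  have hP0 : P = 0 := hind (by rw [hP, map_zero])
  have h0 := congrArg (MvPolynomial.eval ![(0:K₀), 0]) hP0
  have h1 := congrArg (MvPolynomial.eval ![(0:K₀), 1]) hP0
  simp only [P, map_sub, map_add, map_mul, MvPolynomial.eval_C, MvPolynomial.eval_X,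
    Matrix.cons_val_zero, Matrix.cons_val_one, map_zero, mul_zero, mul_one, zero_add,
    zero_sub, neg_eq_zero, sub_eq_zero] at h0 h1
  exact hq (h1.trans h0)

/-- `√2 - 1 ≠ 0` in `K₀`. -/
theorem sqrtTwo_sub_one_ne_zero : (sqrtTwo - 1 : K₀) ≠ 0 := by
  intro h0
  have h1 := congrArg Subtype.val h0
  push_cast [coe_sqrtTwo] at h1
  have hs1 : 1 < Real.sqrt 2 := by
    rw [show (1:ℝ) = Real.sqrt 1 by simp]; exact Real.sqrt_lt_sqrt (by norm_num) (by norm_num)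
  change Real.sqrt 2 - 1 = 0 at h1
  linarith

/-- **`E(k₁) = (√2-1)·a + (2√2-2)·b` is transcendental.** -/
theorem transcendental_ellE_landenOne : Transcendental ℚ
    (ellE (landenMod kL) (isAlgebraic_landenMod isAlgebraic_kL) (landenMod_mem kL_mem)).value := by
  have hq : (2 * (sqrtTwo - 1) : K₀) ≠ 0 := mul_ne_zero two_ne_zero sqrtTwo_sub_one_ne_zero
  have e : ((sqrtTwo - 1 : K₀) : ℝ) * lemnA2.value + ((2 * (sqrtTwo - 1) : K₀) : ℝ) * lemnB2.value
      = (Real.sqrt 2 - 1) * lemnA2.value + (2 * Real.sqrt 2 - 2) * lemnB2.value := by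
    have h2 : ((2 : K₀) : ℝ) = 2 := rfl
    push_cast [coe_sqrtTwo, h2]; ring
  rw [ellE_landenOne_value, ← e]
  exact transcendental_lemn_comb _ _ hq

/-- **`E(k₋) = a + (√2-1)·b` is transcendental.** -/
theorem transcendental_ellE_kD : Transcendental ℚ
    (ellE (kD ^ 2) (isAlgebraic_kD.pow 2) (sq_mem_Ioo kD kD_mem)).value := by
  have e : ((1 : K₀) : ℝ) * lemnA2.value + ((sqrtTwo - 1 : K₀) : ℝ) * lemnB2.value
      = lemnA2.value + (Real.sqrt 2 - 1) * lemnB2.value := by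
    push_cast [coe_sqrtTwo]; ring
  rw [ellE_kD_value, ← e]
  exact transcendental_lemn_comb _ _ sqrtTwo_sub_one_ne_zero

/-! ## The whole tower over `k₋`: `k₋, √½, √λ₁, …` -/

/-- The first step of the tower over `k₋` is the lemniscatic modulus: `landenSeq k₋ 1 = k_L`. -/
theorem landenSeq_kD_one : landenSeq kD 1 = kL := by
  rw [landenSeq_succ, landenSeq_zero, landenMod_kD, Real.sqrt_sq kL_mem.1.le]

/-- The second step: `(landenSeq k₋ 2)² = λ₁ = 12√2 - 16`. -/
theorem landenSeq_kD_two_sq : landenSeq kD 2 ^ 2 = 12 * Real.sqrt 2 - 16 := by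
  rw [landenSeq_succ_sq kD_mem 1, landenSeq_kD_one, landenMod_kL]

/-- **The ascending Landen tower over `k₋ = 3 - 2√2` lies in `M(A₂,B₂)`**: for every `n`,
`K_{k_n²}, E_{k_n²} ∈ M(A₂,B₂)` where `k₀ = 3 - 2√2`, `k_{n+1} = 2√k_n/(1+k_n)`
(`k₁² = ½`, `k₂² = 12√2 - 16`, …). -/
theorem of_landenSeq_kD_mem_lemniscateSector (n : ℕ) :
    of (ellK (landenSeq kD n ^ 2) ((isAlgebraic_landenSeq isAlgebraic_kD kD_mem n).pow 2)
        (sq_mem_Ioo _ (landenSeq_mem kD_mem n))) ∈ lemniscateSector ∧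
      of (ellE (landenSeq kD n ^ 2) ((isAlgebraic_landenSeq isAlgebraic_kD kD_mem n).pow 2)
        (sq_mem_Ioo _ (landenSeq_mem kD_mem n))) ∈ lemniscateSector := by
  have h := landen_tower_mem isAlgebraic_kD kD_mem _
    (mem_lemniscateSector.mp of_ellK_ellE_kD_mem_lemniscateSector.1)
    (mem_lemniscateSector.mp of_ellK_ellE_kD_mem_lemniscateSector.2) n
  exact ⟨mem_lemniscateSector.mpr h.1, mem_lemniscateSector.mpr h.2⟩

/-- **The Kontsevich–Zagier conjecture for the whole tower (unconditional):** for every `n`, any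
integral representation in `M(A₂,B₂)` with period `K(k_n)` is KZ-equivalent to `K_{k_n²}`. -/
theorem kz_ellK_landenSeq (n : ℕ) {m : ℕ} (r' : IntegralRep m) (hr' : of r' ∈ lemniscateSector)
    (hv : (ellK (landenSeq kD n ^ 2) ((isAlgebraic_landenSeq isAlgebraic_kD kD_mem n).pow 2)
      (sq_mem_Ioo _ (landenSeq_mem kD_mem n))).value = r'.value) :
    Equivalent (ellK (landenSeq kD n ^ 2) ((isAlgebraic_landenSeq isAlgebraic_kD kD_mem n).pow 2)
      (sq_mem_Ioo _ (landenSeq_mem kD_mem n))) r' :=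
  kz_lemniscateSector _ _ (of_landenSeq_kD_mem_lemniscateSector n).1 hr' hv

/-- The same for the second kind `E_{k_n²}`. -/
theorem kz_ellE_landenSeq (n : ℕ) {m : ℕ} (r' : IntegralRep m) (hr' : of r' ∈ lemniscateSector)
    (hv : (ellE (landenSeq kD n ^ 2) ((isAlgebraic_landenSeq isAlgebraic_kD kD_mem n).pow 2)
      (sq_mem_Ioo _ (landenSeq_mem kD_mem n))).value = r'.value) :
    Equivalent (ellE (landenSeq kD n ^ 2) ((isAlgebraic_landenSeq isAlgebraic_kD kD_mem n).pow 2)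
      (sq_mem_Ioo _ (landenSeq_mem kD_mem n))) r' :=
  kz_lemniscateSector _ _ (of_landenSeq_kD_mem_lemniscateSector n).2 hr' hv

/-! ## The whole descending tower under `½`: `½, k₋², …` -/

/-- The first descending step from `½` is `k₋²`: `k(½) = k₋`. -/
theorem landenInv_half : landenInv (kL ^ 2) = kD := by
  have h22 : Real.sqrt 2 * Real.sqrt 2 = 2 := Real.mul_self_sqrt zero_le_two
  have hs : Real.sqrt (1 - kL ^ 2) = kL := by
    rw [kL_sq, show (1:ℝ) - 1 / 2 = 1 / 2 from by norm_num, ← kL_sq, Real.sqrt_sq kL_mem.1.le]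
  have hd : (1 + kL) ≠ 0 := by linarith [kL_mem.1]
  rw [landenInv, hs, div_eq_iff hd, kD, kL]
  linear_combination h22

/-- **The descending Landen tower under `½` lies in `M(A₂,B₂)`**: for every `n`,
`K_{μ_n}, E_{μ_n} ∈ M(A₂,B₂)` where `μ₀ = ½`, `μ_{n+1} = k(μ_n)²` (`μ₁ = k₋² = 17 - 12√2`, …). -/
theorem of_landenDesc_half_mem_lemniscateSector (n : ℕ) :
    of (ellK (landenDesc (kL ^ 2) n) (isAlgebraic_landenDesc (isAlgebraic_kL.pow 2)
        (sq_mem_Ioo kL kL_mem) n) (landenDesc_mem (sq_mem_Ioo kL kL_mem) n)) ∈ lemniscateSector ∧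
      of (ellE (landenDesc (kL ^ 2) n) (isAlgebraic_landenDesc (isAlgebraic_kL.pow 2)
        (sq_mem_Ioo kL kL_mem) n) (landenDesc_mem (sq_mem_Ioo kL kL_mem) n)) ∈
        lemniscateSector := by
  have h := landen_desc_tower_mem (isAlgebraic_kL.pow 2) (sq_mem_Ioo kL kL_mem) _
    (mem_lemniscateSector.mp of_ellK_half_mem_lemniscateSector)
    (mem_lemniscateSector.mp of_ellE_half_mem_lemniscateSector) n
  exact ⟨mem_lemniscateSector.mpr h.1, mem_lemniscateSector.mpr h.2⟩

/-- **KZ for the whole descending tower (unconditional).** -/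
theorem kz_ellK_landenDesc (n : ℕ) {m : ℕ} (r' : IntegralRep m) (hr' : of r' ∈ lemniscateSector)
    (hv : (ellK (landenDesc (kL ^ 2) n) (isAlgebraic_landenDesc (isAlgebraic_kL.pow 2)
      (sq_mem_Ioo kL kL_mem) n) (landenDesc_mem (sq_mem_Ioo kL kL_mem) n)).value = r'.value) :
    Equivalent (ellK (landenDesc (kL ^ 2) n) (isAlgebraic_landenDesc (isAlgebraic_kL.pow 2)
      (sq_mem_Ioo kL kL_mem) n) (landenDesc_mem (sq_mem_Ioo kL kL_mem) n)) r' :=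
  kz_lemniscateSector _ _ (of_landenDesc_half_mem_lemniscateSector n).1 hr' hv

/-- The same for the second kind. -/
theorem kz_ellE_landenDesc (n : ℕ) {m : ℕ} (r' : IntegralRep m) (hr' : of r' ∈ lemniscateSector)
    (hv : (ellE (landenDesc (kL ^ 2) n) (isAlgebraic_landenDesc (isAlgebraic_kL.pow 2)
      (sq_mem_Ioo kL kL_mem) n) (landenDesc_mem (sq_mem_Ioo kL kL_mem) n)).value = r'.value) :
    Equivalent (ellE (landenDesc (kL ^ 2) n) (isAlgebraic_landenDesc (isAlgebraic_kL.pow 2)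
      (sq_mem_Ioo kL kL_mem) n) (landenDesc_mem (sq_mem_Ioo kL kL_mem) n)) r' :=
  kz_lemniscateSector _ _ (of_landenDesc_half_mem_lemniscateSector n).2 hr' hv

/-- **The Kontsevich–Zagier conjecture holds for `K_{λ₁}` against the whole lemniscate sector
(unconditional).** Any integral representation in `M(A₂,B₂)` — in any dimension — with period
`K(k₁) = (1+√2) ∫₀¹ dx/√(1-x⁴)` is KZ-equivalent to `K_{λ₁}`. -/
theorem kz_ellK_landenOne {m : ℕ} (r' : IntegralRep m) (hr' : of r' ∈ lemniscateSector)
    (hv : (ellK (landenMod kL) (isAlgebraic_landenMod isAlgebraic_kL)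
      (landenMod_mem kL_mem)).value = r'.value) :
    Equivalent (ellK (landenMod kL) (isAlgebraic_landenMod isAlgebraic_kL) (landenMod_mem kL_mem))
      r' :=
  kz_lemniscateSector _ _ of_ellK_landenOne_mem_lemniscateSector hr' hv

/-- The same for `E_{λ₁}`. -/
theorem kz_ellE_landenOne {m : ℕ} (r' : IntegralRep m) (hr' : of r' ∈ lemniscateSector)
    (hv : (ellE (landenMod kL) (isAlgebraic_landenMod isAlgebraic_kL)
      (landenMod_mem kL_mem)).value = r'.value) :
    Equivalent (ellE (landenMod kL) (isAlgebraic_landenMod isAlgebraic_kL) (landenMod_mem kL_mem))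
      r' :=
  kz_lemniscateSector _ _ of_ellE_landenOne_mem_lemniscateSector hr' hv

end LemniscaticOrbit

end SoloBlind

end Summit.KontsevichZagierPeriods.KontsevichZagierPeriods.Theorems
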